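import Summits.Ventures.HSemireg.WedgeHankelRecurrenceGaussAntiGauss

/-!
# Venture HSemireg — **GOLUB'S GAUSS–RADAU RULE BY MODIFYING THE LAST DIAGONAL COEFFICIENT (1973)**: replacing `a_{t+1}` by `ã = c − b_{t+1} q_t(c)∕q_{t+1}(c)` (any `c` with `q_{t+1}(c) ≠ 0`;
# all other coefficients unchanged) gives `q̃_n = q_n` (`n ≤ t+1`) and `q̃_{t+2} = q_{t+2} + (a_{t+1} − ã) q_{t+1}`, which VANISHES AT `c`; the Favard rule `(ν, y)` of `q̃` at level
# `t + 1` (`t + 2` nodes, one of them `c`, all weights positive) is exact for the reference rule in degree `≤ 2t + 2`: `Σ_K ν_K f(y_K) = Σ_K M_K f(X_K)` (`(M, X)` the `(t+2)`-point Favard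
# rule of `q`) — one degree less than Gauss, one prescribed node: the Gauss–Radau rule

HONEST FRAMING. Part of the Lean index of the computation cell `pub-hsemireg` (seat p10 gen 45, Sunday typer «UNIFORM-IN-n»).  Real polynomials and finite sums only (`Polynomial.modByMonic`); no
variety, no cohomology theory, no sheaf, no Ext group and no semiregularity map is constructed here; nothing here says that HC / HC_CM / HC_AV holds; no Literature fact (unproved `Prop`) is declared
or used.  Custodian versions as in `WedgeHankelSiegelIdeal` (1/3).
SOURCES (cited).  G. H. Golub, *Some modified matrix eigenvalue problems*, SIAM Rev. 15 (1973) 318–334, §6 (Gauss–Radau by modifying `α_{n+1}`, eq. (6.4)); W. Gautschi, *Orthogonal Polynomials: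
Computation and Approximation* (2004) §3.1.1.2, Thm 3.2; G. H. Golub, G. Meurant, *Matrices, Moments and Quadrature with Applications* (2010) §6.2.
PROOF TYPED HERE.  As N366: with `L(F) = Σ M F(X)` the level-`(t+1)` pairing gives `L(q_i q_j) = δ_{ij} h_j` (`i, j ≤ t+1`) and `L(q̃_{t+2} q_j) = 0` for `j ≤ t` (`q_{t+2}(X_K) = 0`,
`q_{t+1} ⟂ q_j`); N366 `functional_vanish_of_monic_family` extends to `deg G ≤ t` and identifies the two rules in degree `≤ t + 1`; division by the monic `q̃_{t+2}` gives exactness in degree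
`≤ (t+2) + t`.  The node: `q̃_{t+2}(c) = (c − ã) q_{t+1}(c) − b_{t+1} q_t(c) = 0` by the choice of `ã`.
DEDUP DISCLOSURE (`rg -n 'radau' Summits/Ventures/HSemireg`, 2026-09-03): N276 constructs the Radau rule from the Gauss rule of `(V − c)M` (measure side), N343 proves its uniqueness; Golub's
recurrence-modification form is new.  The 10 names below: 0 hits tree-wide.

WHAT IS IN THE TREE.  N337 `recurrence_eval_signs_outside`; N346 `zeros_rank_one_interlace`; N366 `functional_vanish_of_monic_family`, `sum_mul_eval_mul_add`, `sum_mul_eval_mul_smul`; N323 `favard_pairing_at_zeros`; N279 `recurrence_monic_natDegree`,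
`recurrence_zeros_interlace`, `eq_prod_X_sub_C_of_monic_of_roots`; Mathlib `Polynomial.modByMonic_add_div`, `natDegree_modByMonic_lt`, `natDegree_divByMonic`.
THIS FILE (namespace `Summit.Ventures.HSemireg.Wedge.HankelOuter` continued; CHAINED on N366 (import only); 0 definitions):
* §1132 `radauGolub_recurrence_eq` (`q̃_n = q_n`, `n ≤ t+1`; `q̃_{t+2} = q_{t+2} + C(a_{t+1} − ã) q_{t+1}`), **`radauGolub_node`** (`q̃_{t+2}(c) = 0` for Golub's `ã`), `radauGolub_top_orthogonal`
  (`Σ M (q̃_{t+2} G)(X) = 0`, `deg G ≤ t`), `radauGolub_low_degree` (`Σ ν R(y) = Σ M R(X)`, `deg R ≤ t+1`), **`radauGolub_exact`** (`Σ ν f(y) = Σ M f(X)`, `deg f ≤ 2t+2`),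
  **`radauGolub_rule`** (packaged: positive weights, `c` is a node, exactness in degree `≤ 2t + 2`), `radauGolub_nodes_interlace` (Radau nodes interlace the Gauss nodes), `radauGolub_shift_eq` (`ã − a_{t+1} = q_{t+2}(c)∕q_{t+1}(c)`), **`radauGolub_nodes_right`** ∕ **`radauGolub_nodes_left`** (for `c` right ∕ left of
  the spectrum: the free nodes interlace the `(t+2)`-point Gauss nodes and the extreme node is `c`).
CAVEATS.  Positive recurrences; `q_{t+1}(c) ≠ 0`; the reference functional is the `(t+2)`-point Favard rule (it agrees with any underlying measure in degree `≤ 2t + 3`).  Nothing Ext-side.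
New names only.
-/

open Module Polynomial
open scoped Matrix Polynomial

namespace Summit.Ventures.HSemireg.Wedge.HankelOuter

/-! ## §1132. Gauss–Radau by a modified last diagonal coefficient -/

/-- **Modifying the last diagonal coefficient: `q̃_n = q_n` for `n ≤ t + 1` and `q̃_{t+2} = q_{t+2} + C(a_{t+1} − a'_{t+1}) q_{t+1}`.** [Golub 1973 §6; this file, §1132] -/
theorem radauGolub_recurrence_eq {q q' : ℕ → ℝ[X]} {a a' b : ℕ → ℝ} (hq0 : q 0 = 1) (hq1 : q 1 = Polynomial.X - C (a 0))
    (hrec : ∀ n, q (n + 2) = (Polynomial.X - C (a (n + 1))) * q (n + 1) - C (b (n + 1)) * q n)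
    (hq0' : q' 0 = 1) (hq1' : q' 1 = Polynomial.X - C (a' 0)) (hrec' : ∀ n, q' (n + 2) = (Polynomial.X - C (a' (n + 1))) * q' (n + 1) - C (b (n + 1)) * q' n)
    {t : ℕ} (ha' : ∀ n, n ≠ t + 1 → a' n = a n) :
    (∀ n, n ≤ t + 1 → q' n = q n) ∧ q' (t + 2) = q (t + 2) + C (a (t + 1) - a' (t + 1)) * q (t + 1) := by
  have hbelow := rank_one_perturbation_eq_below hq0 hq1 hrec hq0' hq1' hrec' (i := t + 1) ha'
  refine ⟨hbelow, ?_⟩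
  rw [hrec' t, hrec t, hbelow (t + 1) le_rfl, hbelow t (by omega), C_sub]
  ring

/-- **GOLUB'S CHOICE `ã = c − b_{t+1} q_t(c)∕q_{t+1}(c)` MAKES `c` A ZERO OF `q̃_{t+2}`.** [Golub 1973 (6.4); Gautschi Thm 3.2; this file, §1132] -/
theorem radauGolub_node {q q' : ℕ → ℝ[X]} {a a' b : ℕ → ℝ} (hq0 : q 0 = 1) (hq1 : q 1 = Polynomial.X - C (a 0))
    (hrec : ∀ n, q (n + 2) = (Polynomial.X - C (a (n + 1))) * q (n + 1) - C (b (n + 1)) * q n)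
    (hq0' : q' 0 = 1) (hq1' : q' 1 = Polynomial.X - C (a' 0)) (hrec' : ∀ n, q' (n + 2) = (Polynomial.X - C (a' (n + 1))) * q' (n + 1) - C (b (n + 1)) * q' n)
    {t : ℕ} (ha' : ∀ n, n ≠ t + 1 → a' n = a n) {c : ℝ} (hc : (q (t + 1)).eval c ≠ 0) (hat : a' (t + 1) = c - b (t + 1) * (q t).eval c / (q (t + 1)).eval c) :
    (q' (t + 2)).eval c = 0 := by
  obtain ⟨hbelow, -⟩ := radauGolub_recurrence_eq hq0 hq1 hrec hq0' hq1' hrec' ha'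
  rw [hrec' t, hbelow (t + 1) le_rfl, hbelow t (by omega), hat]
  simp only [eval_sub, eval_mul, eval_X, eval_C]
  field_simp
  ring

/-- **`Σ_K M_K (q̃_{t+2} G)(X_K) = 0` for `deg G ≤ t`** (`(M, X)` the level-`(t+1)` Favard pairing of `q`). [Golub 1973 §6; this file, §1132] -/
theorem radauGolub_top_orthogonal {q : ℕ → ℝ[X]} {a b : ℕ → ℝ} (hq0 : q 0 = 1) (hq1 : q 1 = Polynomial.X - C (a 0))
    (hrec : ∀ n, q (n + 2) = (Polynomial.X - C (a (n + 1))) * q (n + 1) - C (b (n + 1)) * q n)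
    {t : ℕ} {M X : Fin (t + 2) → ℝ} (hXr : ∀ k, (q (t + 2)).eval (X k) = 0)
    (hPair : ∀ i j : Fin (t + 2), ∑ k, M k * ((q i).eval (X k) * (q j).eval (X k)) = if i = j then ∏ l ∈ Finset.Ico 1 ((j : ℕ) + 1), b l else 0)
    (s : ℝ) {G : ℝ[X]} (hG : G.natDegree ≤ t) :
    ∑ k, M k * ((q (t + 2) + C s * q (t + 1)) * G).eval (X k) = 0 := by
  refine functional_vanish_of_monic_family (Φ := fun F => ∑ k, M k * ((q (t + 2) + C s * q (t + 1)) * F).eval (X k))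
    (fun F G => by simp only [sum_mul_eval_mul_add]) (fun c F => by simp only [sum_mul_eval_mul_smul])
    (fun d hd => (recurrence_monic_natDegree hq0 hq1 hrec d).1) (fun d hd => (recurrence_monic_natDegree hq0 hq1 hrec d).2) (fun d hd => ?_) hG
  have h := hPair ⟨t + 1, by omega⟩ ⟨d, by omega⟩
  rw [if_neg (fun h' => by have := Fin.mk.inj_iff.1 h'; omega)] at h
  dsimp only at h
  have e : ∀ k, M k * ((q (t + 2) + C s * q (t + 1)) * q d).eval (X k) = s * (M k * ((q (t + 1)).eval (X k) * (q d).eval (X k))) := fun k => by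
    simp only [eval_mul, eval_add, eval_C, hXr k, zero_add]; ring
  rw [Finset.sum_congr rfl fun k _ => e k, ← Finset.mul_sum, h, mul_zero]

/-- **In degree `≤ t + 1` the modified Favard rule agrees with the reference rule: `Σ ν R(y) = Σ M R(X)`.** [this file, §1132] -/
theorem radauGolub_low_degree {q q' : ℕ → ℝ[X]} {a a' b : ℕ → ℝ} (hq0 : q 0 = 1) (hq1 : q 1 = Polynomial.X - C (a 0))
    (hrec : ∀ n, q (n + 2) = (Polynomial.X - C (a (n + 1))) * q (n + 1) - C (b (n + 1)) * q n)
    (hq0' : q' 0 = 1) (hq1' : q' 1 = Polynomial.X - C (a' 0)) (hrec' : ∀ n, q' (n + 2) = (Polynomial.X - C (a' (n + 1))) * q' (n + 1) - C (b (n + 1)) * q' n)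
    {t : ℕ} (ha' : ∀ n, n ≠ t + 1 → a' n = a n) {M X ν y : Fin (t + 2) → ℝ}
    (hPair : ∀ i j : Fin (t + 2), ∑ k, M k * ((q i).eval (X k) * (q j).eval (X k)) = if i = j then ∏ l ∈ Finset.Ico 1 ((j : ℕ) + 1), b l else 0)
    (hpair' : ∀ i j : Fin (t + 2), ∑ k, ν k * ((q' i).eval (y k) * (q' j).eval (y k)) = if i = j then ∏ l ∈ Finset.Ico 1 ((j : ℕ) + 1), b l else 0)
    {R : ℝ[X]} (hR : R.natDegree ≤ t + 1) : ∑ k, ν k * R.eval (y k) = ∑ k, M k * R.eval (X k) := by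
  obtain ⟨hbelow, -⟩ := radauGolub_recurrence_eq hq0 hq1 hrec hq0' hq1' hrec' ha'
  have h := functional_vanish_of_monic_family (Φ := fun F => ∑ k, ν k * F.eval (y k) - ∑ k, M k * F.eval (X k))
    (fun F G => by
      have h1 := sum_mul_eval_mul_add ν y 1 F G; have h2 := sum_mul_eval_mul_add M X 1 F G
      simp only [one_mul] at h1 h2; rw [h1, h2]; ring)
    (fun c F => by
      have h1 := sum_mul_eval_mul_smul ν y 1 F c; have h2 := sum_mul_eval_mul_smul M X 1 F c
      simp only [one_mul] at h1 h2; rw [h1, h2]; ring)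
    (fun d hd => (recurrence_monic_natDegree hq0 hq1 hrec d).1) (fun d hd => (recurrence_monic_natDegree hq0 hq1 hrec d).2) (fun d hd => ?_) hR
  · simpa [sub_eq_zero] using h
  · have h1 := hpair' ⟨d, by omega⟩ ⟨0, by omega⟩
    have h2 := hPair ⟨d, by omega⟩ ⟨0, by omega⟩
    rw [hbelow d hd, hq0'] at h1
    rw [hq0] at h2
    simp only [eval_one, mul_one] at h1 h2
    rw [h1, h2, sub_self]

/-- **GOLUB'S RADAU THEOREM: `Σ_K ν_K f(y_K) = Σ_K M_K f(X_K)` for `deg f ≤ 2t + 2`** (`(ν, y)` the level-`(t+1)` Favard pairing of the modified recurrence, `(M, X)` that of `q`; the value of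
`a'_{t+1}` is arbitrary here). [Golub 1973 §6; Gautschi Thm 3.2; this file, §1132] -/
theorem radauGolub_exact {q q' : ℕ → ℝ[X]} {a a' b : ℕ → ℝ} (hq0 : q 0 = 1) (hq1 : q 1 = Polynomial.X - C (a 0))
    (hrec : ∀ n, q (n + 2) = (Polynomial.X - C (a (n + 1))) * q (n + 1) - C (b (n + 1)) * q n)
    (hq0' : q' 0 = 1) (hq1' : q' 1 = Polynomial.X - C (a' 0)) (hrec' : ∀ n, q' (n + 2) = (Polynomial.X - C (a' (n + 1))) * q' (n + 1) - C (b (n + 1)) * q' n)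
    {t : ℕ} (ha' : ∀ n, n ≠ t + 1 → a' n = a n) {M X ν y : Fin (t + 2) → ℝ}
    (hXq : q (t + 2) = ∏ k, (Polynomial.X - C (X k))) (hyq : q' (t + 2) = ∏ k, (Polynomial.X - C (y k)))
    (hPair : ∀ i j : Fin (t + 2), ∑ k, M k * ((q i).eval (X k) * (q j).eval (X k)) = if i = j then ∏ l ∈ Finset.Ico 1 ((j : ℕ) + 1), b l else 0)
    (hpair' : ∀ i j : Fin (t + 2), ∑ k, ν k * ((q' i).eval (y k) * (q' j).eval (y k)) = if i = j then ∏ l ∈ Finset.Ico 1 ((j : ℕ) + 1), b l else 0)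
    {f : ℝ[X]} (hf : f.natDegree ≤ 2 * t + 2) : ∑ k, ν k * f.eval (y k) = ∑ k, M k * f.eval (X k) := by
  have hXr : ∀ k, (q (t + 2)).eval (X k) = 0 := fun k => by
    rw [hXq, eval_prod]; exact Finset.prod_eq_zero (Finset.mem_univ k) (by rw [eval_sub, eval_X, eval_C, sub_self])
  have hyr : ∀ k, (q' (t + 2)).eval (y k) = 0 := fun k => by
    rw [hyq, eval_prod]; exact Finset.prod_eq_zero (Finset.mem_univ k) (by rw [eval_sub, eval_X, eval_C, sub_self])
  obtain ⟨-, htop⟩ := radauGolub_recurrence_eq hq0 hq1 hrec hq0' hq1' hrec' ha'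
  obtain ⟨hm', hd'⟩ := recurrence_monic_natDegree hq0' hq1' hrec' (t + 2)
  obtain ⟨G, hG⟩ : ∃ G : ℝ[X], G = f /ₘ q' (t + 2) := ⟨_, rfl⟩
  obtain ⟨R, hR⟩ : ∃ R : ℝ[X], R = f %ₘ q' (t + 2) := ⟨_, rfl⟩
  have hfGR : f = q' (t + 2) * G + R := by rw [hG, hR, add_comm, modByMonic_add_div f (q' (t + 2))]
  have hRd : R.natDegree ≤ t + 1 := by
    have hne : q' (t + 2) ≠ 1 := fun h => by have := congrArg natDegree h; rw [hd', natDegree_one] at this; omega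
    have := natDegree_modByMonic_lt f hm' hne
    rw [hd'] at this; rw [hR]; omega
  have hGd : G.natDegree ≤ t := by
    rw [hG, natDegree_divByMonic f hm', hd']; omega
  have h1 := radauGolub_top_orthogonal hq0 hq1 hrec hXr hPair (a (t + 1) - a' (t + 1)) hGd
  have h2 := radauGolub_low_degree hq0 hq1 hrec hq0' hq1' hrec' ha' hPair hpair' hRd
  rw [← htop] at h1
  have h3 : ∑ k, ν k * f.eval (y k) = ∑ k, ν k * R.eval (y k) := Finset.sum_congr rfl fun k _ => by rw [hfGR, eval_add, eval_mul, hyr k, zero_mul, zero_add]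
  have h4 : ∑ k, M k * f.eval (X k) = ∑ k, M k * (q' (t + 2) * G).eval (X k) + ∑ k, M k * R.eval (X k) := by
    rw [← Finset.sum_add_distrib]; exact Finset.sum_congr rfl fun k _ => by rw [hfGR, eval_add]; ring
  rw [h3, h4, h1, zero_add, h2]

/-- **THE GAUSS–RADAU RULE À LA GOLUB, PACKAGED**: positive recurrence, `q_{t+1}(c) ≠ 0`, `a'_{t+1} = c − b_{t+1} q_t(c)∕q_{t+1}(c)` (other coefficients equal); with `X` the zeros of
`q_{t+2}` and `y` those of `q̃_{t+2}`: `c` is one of the `y_K`, and there are POSITIVE weights `M, ν` with `Σ ν f(y) = Σ M f(X)` for `deg f ≤ 2t + 2`. [Golub 1973 §6; this file, §1132] -/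
theorem radauGolub_rule {q q' : ℕ → ℝ[X]} {a a' b : ℕ → ℝ} (hq0 : q 0 = 1) (hq1 : q 1 = Polynomial.X - C (a 0))
    (hrec : ∀ n, q (n + 2) = (Polynomial.X - C (a (n + 1))) * q (n + 1) - C (b (n + 1)) * q n)
    (hq0' : q' 0 = 1) (hq1' : q' 1 = Polynomial.X - C (a' 0)) (hrec' : ∀ n, q' (n + 2) = (Polynomial.X - C (a' (n + 1))) * q' (n + 1) - C (b (n + 1)) * q' n)
    (hb : ∀ j, 0 < b j) {t : ℕ} (ha' : ∀ n, n ≠ t + 1 → a' n = a n) {c : ℝ} (hc : (q (t + 1)).eval c ≠ 0) (hat : a' (t + 1) = c - b (t + 1) * (q t).eval c / (q (t + 1)).eval c)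
    {X y : Fin (t + 2) → ℝ} (hX : StrictMono X) (hXq : q (t + 2) = ∏ k, (Polynomial.X - C (X k))) (hy : StrictMono y) (hyq : q' (t + 2) = ∏ k, (Polynomial.X - C (y k))) :
    (∃ K, y K = c) ∧ ∃ (M ν : Fin (t + 2) → ℝ), (∀ k, 0 < M k) ∧ (∀ k, 0 < ν k) ∧ ∀ f : ℝ[X], f.natDegree ≤ 2 * t + 2 → ∑ k, ν k * f.eval (y k) = ∑ k, M k * f.eval (X k) := by
  obtain ⟨M, hM, hPair⟩ := favard_pairing_at_zeros hq0 hq1 hrec hb (t := t + 1) hX hXq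
  obtain ⟨ν, hν, hpair'⟩ := favard_pairing_at_zeros hq0' hq1' hrec' hb (t := t + 1) hy hyq
  refine ⟨?_, M, ν, hM, hν, fun f hf => radauGolub_exact hq0 hq1 hrec hq0' hq1' hrec' ha' hXq hyq hPair hpair' hf⟩
  have h0 := radauGolub_node hq0 hq1 hrec hq0' hq1' hrec' ha' hc hat
  rw [hyq, eval_prod, Finset.prod_eq_zero_iff] at h0
  obtain ⟨K, -, hK⟩ := h0
  rw [eval_sub, eval_X, eval_C, sub_eq_zero] at hK
  exact ⟨K, hK.symm⟩

/-- **The Radau nodes interlace the Gauss nodes: `y_k < x_k < y_{k+1}`** (`x` the zeros of `q_{t+1} = q̃_{t+1}`, `y` those of `q̃_{t+2}`; any modification `a'_{t+1}` of the last diagonal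
coefficient). [Golub 1973 §6; N279; this file, §1132] -/
theorem radauGolub_nodes_interlace {q q' : ℕ → ℝ[X]} {a a' b : ℕ → ℝ} (hq0 : q 0 = 1) (hq1 : q 1 = Polynomial.X - C (a 0))
    (hrec : ∀ n, q (n + 2) = (Polynomial.X - C (a (n + 1))) * q (n + 1) - C (b (n + 1)) * q n)
    (hq0' : q' 0 = 1) (hq1' : q' 1 = Polynomial.X - C (a' 0)) (hrec' : ∀ n, q' (n + 2) = (Polynomial.X - C (a' (n + 1))) * q' (n + 1) - C (b (n + 1)) * q' n)
    (hb : ∀ j, 0 < b j) {t : ℕ} (ha' : ∀ n, n ≠ t + 1 → a' n = a n)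
    {x : Fin (t + 1) → ℝ} {y : Fin (t + 2) → ℝ} (hx : StrictMono x) (hxq : q (t + 1) = ∏ k, (Polynomial.X - C (x k))) (hy : StrictMono y) (hyq : q' (t + 2) = ∏ k, (Polynomial.X - C (y k)))
    (k : Fin (t + 1)) : y k.castSucc < x k ∧ x k < y k.succ := by
  obtain ⟨hbelow, -⟩ := radauGolub_recurrence_eq hq0 hq1 hrec hq0' hq1' hrec' ha'
  obtain ⟨z, w, hz, hw, hzq, hwq, hzw⟩ := recurrence_zeros_interlace hq0' hq1' hrec' hb t
  have hzx : z = x := strictMono_eq_of_prod_X_sub_C_eq hz hx (hzq.symm.trans ((hbelow (t + 1) le_rfl).trans hxq))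
  have hwy : w = y := strictMono_eq_of_prod_X_sub_C_eq hw hy (hwq.symm.trans hyq)
  subst hzx hwy
  exact hzw k

/-- **Golub's shift in closed form: `ã − a_{t+1} = q_{t+2}(c)∕q_{t+1}(c)`.** [Golub 1973 (6.4); this file, §1132] -/
theorem radauGolub_shift_eq {q : ℕ → ℝ[X]} {a a' b : ℕ → ℝ}
    (hrec : ∀ n, q (n + 2) = (Polynomial.X - C (a (n + 1))) * q (n + 1) - C (b (n + 1)) * q n)
    {t : ℕ} {c : ℝ} (hc : (q (t + 1)).eval c ≠ 0) (hat : a' (t + 1) = c - b (t + 1) * (q t).eval c / (q (t + 1)).eval c) :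
    a' (t + 1) - a (t + 1) = (q (t + 2)).eval c / (q (t + 1)).eval c := by
  rw [hat, hrec t]
  simp only [eval_sub, eval_mul, eval_X, eval_C]
  field_simp
  ring

/-- **RADAU WITH `c` TO THE RIGHT OF THE SPECTRUM: `ã > a_{t+1}`, the free nodes interlace the `(t+2)`-point Gauss nodes, `X_k ≤ y_k ≤ X_{k+1}` (`k ≤ t`), and the largest node is `c`.**
[Golub 1973 §6; this file, §1132] -/
theorem radauGolub_nodes_right {q q' : ℕ → ℝ[X]} {a a' b : ℕ → ℝ} (hq0 : q 0 = 1) (hq1 : q 1 = Polynomial.X - C (a 0))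
    (hrec : ∀ n, q (n + 2) = (Polynomial.X - C (a (n + 1))) * q (n + 1) - C (b (n + 1)) * q n)
    (hq0' : q' 0 = 1) (hq1' : q' 1 = Polynomial.X - C (a' 0)) (hrec' : ∀ n, q' (n + 2) = (Polynomial.X - C (a' (n + 1))) * q' (n + 1) - C (b (n + 1)) * q' n)
    (hb : ∀ j, 0 < b j) {t : ℕ} (ha' : ∀ n, n ≠ t + 1 → a' n = a n) {c : ℝ} (hat : a' (t + 1) = c - b (t + 1) * (q t).eval c / (q (t + 1)).eval c)
    {X y : Fin (t + 2) → ℝ} (hX : StrictMono X) (hXq : q (t + 2) = ∏ k, (Polynomial.X - C (X k))) (hy : StrictMono y) (hyq : q' (t + 2) = ∏ k, (Polynomial.X - C (y k)))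
    (hcX : ∀ k, X k < c) :
    a (t + 1) < a' (t + 1) ∧ (∀ k : Fin (t + 2), X k ≤ y k ∧ ∀ hk : (k : ℕ) + 1 ≤ t + 1, y k ≤ X ⟨k + 1, by omega⟩) ∧ y (Fin.last (t + 1)) = c := by
  -- `q_{t+1}(c), q_{t+2}(c) > 0`
  have hroots : ∀ s, (q (t + 2)).eval s = 0 → s < c := fun s hs => by
    rw [hXq, eval_prod, Finset.prod_eq_zero_iff] at hs
    obtain ⟨k, -, hk⟩ := hs
    rw [eval_sub, eval_X, eval_C, sub_eq_zero] at hk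
    rw [hk]; exact hcX k
  obtain ⟨hpos1, hpos2⟩ := (recurrence_eval_signs_outside hq0 hq1 hrec hb (t + 1) c).1 hroots
  have hshift := radauGolub_shift_eq hrec hpos1.ne' hat
  have hlt : a (t + 1) < a' (t + 1) := by have := div_pos hpos2 hpos1; linarith
  have hinter := fun k => zeros_rank_one_interlace hq0 hq1 hrec hq0' hq1' hrec' hb (i₀ := t + 1) hlt.le ha' hX hXq hy hyq k
  refine ⟨hlt, hinter, ?_⟩
  obtain ⟨⟨K, hK⟩, -⟩ := radauGolub_rule hq0 hq1 hrec hq0' hq1' hrec' hb ha' hpos1.ne' hat hX hXq hy hyq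
  rcases eq_or_ne K (Fin.last (t + 1)) with h | h
  · rw [← h, hK]
  · exfalso
    have hK' : (K : ℕ) + 1 ≤ t + 1 := by
      have := K.is_lt; have : (K : ℕ) ≠ t + 1 := fun e => h (Fin.ext (by rw [e, Fin.val_last])); omega
    have h1 := (hinter K).2 hK'
    have h2 := hcX ⟨K + 1, by omega⟩
    rw [hK] at h1
    linarith

/-- **RADAU WITH `c` TO THE LEFT OF THE SPECTRUM: `ã < a_{t+1}`, `y_k ≤ X_k`, `X_k ≤ y_{k+1}`, and the smallest node is `c`.** [Golub 1973 §6; this file, §1132] -/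
theorem radauGolub_nodes_left {q q' : ℕ → ℝ[X]} {a a' b : ℕ → ℝ} (hq0 : q 0 = 1) (hq1 : q 1 = Polynomial.X - C (a 0))
    (hrec : ∀ n, q (n + 2) = (Polynomial.X - C (a (n + 1))) * q (n + 1) - C (b (n + 1)) * q n)
    (hq0' : q' 0 = 1) (hq1' : q' 1 = Polynomial.X - C (a' 0)) (hrec' : ∀ n, q' (n + 2) = (Polynomial.X - C (a' (n + 1))) * q' (n + 1) - C (b (n + 1)) * q' n)
    (hb : ∀ j, 0 < b j) {t : ℕ} (ha' : ∀ n, n ≠ t + 1 → a' n = a n) {c : ℝ} (hat : a' (t + 1) = c - b (t + 1) * (q t).eval c / (q (t + 1)).eval c)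
    {X y : Fin (t + 2) → ℝ} (hX : StrictMono X) (hXq : q (t + 2) = ∏ k, (Polynomial.X - C (X k))) (hy : StrictMono y) (hyq : q' (t + 2) = ∏ k, (Polynomial.X - C (y k)))
    (hcX : ∀ k, c < X k) :
    a' (t + 1) < a (t + 1) ∧ (∀ k : Fin (t + 2), y k ≤ X k ∧ ∀ hk : (k : ℕ) + 1 ≤ t + 1, X k ≤ y ⟨k + 1, by omega⟩) ∧ y 0 = c := by
  have hroots : ∀ s, (q (t + 2)).eval s = 0 → c < s := fun s hs => by
    rw [hXq, eval_prod, Finset.prod_eq_zero_iff] at hs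
    obtain ⟨k, -, hk⟩ := hs
    rw [eval_sub, eval_X, eval_C, sub_eq_zero] at hk
    rw [hk]; exact hcX k
  obtain ⟨hpos1, hpos2⟩ := (recurrence_eval_signs_outside hq0 hq1 hrec hb (t + 1) c).2 hroots
  -- `(−1)^{t+1} q_{t+1}(c) > 0`, `(−1)^{t+2} q_{t+2}(c) > 0`: the quotient `q_{t+2}(c)/q_{t+1}(c)` is negative
  have hne1 : (q (t + 1)).eval c ≠ 0 := fun h => by rw [h, mul_zero] at hpos1; exact lt_irrefl _ hpos1
  have hquot : (q (t + 2)).eval c / (q (t + 1)).eval c < 0 := by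
    have hprod : (q (t + 2)).eval c * (q (t + 1)).eval c < 0 := by
      have e : ((-1 : ℝ) ^ (t + 1) * (q (t + 1)).eval c) * ((-1 : ℝ) ^ (t + 1 + 1) * (q (t + 2)).eval c) = -(((-1 : ℝ) ^ (t + 1)) ^ 2) * ((q (t + 2)).eval c * (q (t + 1)).eval c) := by ring
      have h := mul_pos hpos1 hpos2
      rw [e, show ((-1 : ℝ) ^ (t + 1)) ^ 2 = 1 by rw [← pow_mul, mul_comm, pow_mul, neg_one_sq, one_pow]] at h
      linarith
    rcases lt_or_gt_of_ne hne1 with hn | hp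
    · exact div_neg_of_pos_of_neg (by nlinarith [hprod]) hn
    · exact div_neg_of_neg_of_pos (by nlinarith [hprod]) hp
  have hshift := radauGolub_shift_eq hrec hne1 hat
  have hlt : a' (t + 1) < a (t + 1) := by linarith
  have ha'' : ∀ n, n ≠ t + 1 → a n = a' n := fun n hn => (ha' n hn).symm
  have hinter := fun k => zeros_rank_one_interlace hq0' hq1' hrec' hq0 hq1 hrec hb (i₀ := t + 1) hlt.le ha'' hy hyq hX hXq k
  refine ⟨hlt, hinter, ?_⟩
  obtain ⟨⟨K, hK⟩, -⟩ := radauGolub_rule hq0 hq1 hrec hq0' hq1' hrec' hb ha' hne1 hat hX hXq hy hyq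
  rcases eq_or_ne K 0 with h | h
  · rw [← h, hK]
  · exfalso
    obtain ⟨j, hj⟩ : ∃ j : ℕ, (K : ℕ) = j + 1 := ⟨(K : ℕ) - 1, by have : (K : ℕ) ≠ 0 := fun e => h (Fin.ext e); omega⟩
    have h1 := (hinter ⟨j, by have := K.is_lt; omega⟩).2 (by have := K.is_lt; simp only; omega)
    have h2 := hcX ⟨j, by have := K.is_lt; omega⟩
    have hKe : (⟨j + 1, by have := K.is_lt; omega⟩ : Fin (t + 2)) = K := Fin.ext (by simp [hj])
    rw [hKe, hK] at h1
    linarith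

end Summit.Ventures.HSemireg.Wedge.HankelOuter
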